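import Summits.QuantumFields.BalabanUV.T4Continuum.Support.TermwiseLocalThm1Ledger

/-!
# TermwiseLocalThm1Coarse — two swarm-ready leaves of the ROUND-2 skeleton of road P1 (term-wise) for row NE7,
# discharged: (w2) the FINE-LABEL TRIPLE of the gen-17 END is DERIVED from the coarse window labels, (w3) the constants'
# side conditions are JOINTLY SATISFIABLE once Theorem 1's `M(ε₁)` is unbounded at `0⁺`

Cell `pub-balaban`, rung (B)+1 sub-cell t4, lineage `b2b-balaban-t4-ne7-p1` (node U5 = NE7, TERM-WISE member;
generation 18), skeleton `HOME/t4/b2b-balaban-t4-ne7-p1-g18/SKELETON-NE7-P1.md` §2 leaves B.3 (w2) and B.4 (w3),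
record `t4/T4-EST-NE7-P1.md` §24.  HONEST FRAMING (page 1): FIXED FINITE T⁴, rung (B)+1 = the `ε → 0` limit of
unit-scale averaged expectations, CONDITIONAL on BetaPertH and the nine spine estimates (0/9 proved); NOT infinite
volume, NOT a mass gap, NOT the Clay problem.  NE7 is NOT PRINTED in [Balaban1984PropagatorsI]–[Balaban1989LargeFieldII]
and NOT proved here; nothing below is an estimate.  [folklore] bookkeeping (integer division on `ℤ⁴`, one right-
neighbourhood-of-zero argument, one call of the gen-17 END); no definitions, no cite tags, nothing printed asserted.

WHAT IS PROVED ([folklore]).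
§1 `block_mem_pbox`, `inBox_block` — every plane-labelled site `x` of the FINE box `planes × [0, N·L)⁴` has its block
   label `(x.1, ⌊x.2∕L⌋)` in the COARSE box `planes × [0, N)⁴`, and `x.2` lies in the window box
   `[L·⌊x.2∕L⌋, L·⌊x.2∕L⌋ + (L−1)𝟙 + L e_μ + L e_ν]` (= `B7Prop1Local.deltaHi`, (46) of B7 as typed) of that block for
   ANY plane `(μ, ν)` (the cross-reader's kernel remark I1 on XREAD-REQUEST-11, journal l.4183, made a lemma).
§2 `exists_eps1_smallness` — given Theorem 1's constants `Cst : B11Thm1.Consts`, a block size `L` and a cube-size bound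
   `Mc ≥ 0`, IF `Cst.Mfun` is unbounded at `0⁺` (`∀ m, ∀ᶠ e in 𝓝[>] 0, m ≤ Cst.Mfun e` — the printed form
   `M(ε₁) = R₁M₁(a₁∕ε₁)` p. 279 of [Balaban1985Variational] has this property when `M₁` is unbounded; against the tree's
   ABSTRACT `Consts` it is a HYPOTHESIS), then some `ε₁` satisfies ALL of the END's side conditions at once:
   `0 < ε₁ ≤ min(a₁, 1)`, `Mc ≤ Cst.Mfun ε₁`, `20480·L²·cReg(B₃Mc, B₃Mc)·ε₁ ≤ 1`.  So leaf B.4 is [num], not an estimate.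
§3 `goodClause_summable_UN_levels_of_thm1At_coarse` — the gen-17 END `goodClause_summable_UN_levels_of_thm1At`
   (p204490) with the fine-label triple REMOVED from the hypotheses: `lvlBf`, `hlvlBf`, `hcoverBf`, `hwinBf` are
   PRODUCED inside from `lvlB`, `hlvlB`, `hcoverB`, `hwinB` through `lvlBf K t τ v x := lvlB K t τ v (x.1, ⌊x.2∕L⌋)`
   and §1.  Conclusion LITERALLY the END's (`GoodClause … δ⁗ ∧ Summable δ⁗`, δ⁗ unchanged).  ONE CALL.

BINDER CENSUS of §3 = the END's census (module docstring of `TermwiseLocalThm1Ledger`) MINUS (lvl-f)(cover-f)(win-f);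
every remaining binder keeps its class in SKELETON-NE7-P1 §2 (ROW ∕ β-ROAD ∕ PRINTED-1RUN shape ∕ OWN-OPEN (T.2 margin,
S.4 (γ), S.5 (R-w)(W-w)) ∕ [dict] over NODE O ∕ [geom] ∕ [num]).  NOT NE7, NOT summit progress.
-/

noncomputable section

open Finset MeasureTheory _root_.Filter _root_.Topology
open scoped BigOperators Matrix.Norms.L2Operator

namespace Summit.QuantumFields.BalabanUV.T4Continuum.TermwiseLocal

open Literature.MathematicalPhysics.QuantumFieldTheory.Balaban1983to89
open T4OutputRate T4RecentScale T4GoodClassBudget T4CauchySum T4Crossover T4TowerRateComposition T4TowerRateDischarge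
open T4BoundaryCarrier (BFunctional atFl NE9Fl LipBackgroundFl NE5B)
open T4TermwiseBudget T4TermwiseDeviation T4TermwiseCurrency T4TermwiseBoundary T4TermwiseResidual T4TermwiseAction
open T4TermwiseClassical T4TermwiseQuartic
open T4TermwiseInstantiate (cBCH cBCH_nonneg cSZ cSZ_nonneg)
open T4TermwiseOscillation (cOSC)
open B7Prop1Explicit B7Prop2Explicit B7Prop1Local T4TermwiseBCH T4TermwiseTorus T4TermwiseUN T4TermwiseChainUN B11
open TermwiseBackground (LocReg cReg cOscReg cReg_nonneg)
open TermwiseHolder (HolderReg Realises holderReg_window_family_of_thm1At)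

/-! ## §1 Fine sites ↦ coarse window labels (leaf B.3 / (w2) of SKELETON-NE7-P1) -/

section Blocks

/-- A plane-labelled site of the fine box `planes × [0, N·L)⁴` has its block label `(plane, ⌊x∕L⌋)` in the coarse box
`planes × [0, N)⁴` (`L ≥ 1`). [folklore] -/
theorem block_mem_pbox {planes : Finset (Fin 4 × Fin 4)} {L N : ℕ} (hL : 1 ≤ L)
    {x : (Fin 4 × Fin 4) × B7Prop1Explicit.Site 4} (hx : x ∈ pbox planes (N * L)) :
    (x.1, fun i => x.2 i / (L : ℤ)) ∈ pbox planes N := by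
  simp only [pbox, Finset.mem_product] at hx ⊢
  refine ⟨hx.1, ?_⟩
  have hx2 := mem_box.1 hx.2
  have hL0 : (0 : ℤ) < L := by exact_mod_cast hL
  refine mem_box.2 fun κ => ⟨Int.ediv_nonneg (hx2 κ).1 hL0.le, ?_⟩
  show x.2 κ / (L : ℤ) < (N : ℤ)
  rw [Int.ediv_lt_iff_lt_mul hL0]
  have h := (hx2 κ).2
  push_cast at h
  linarith

/-- Every site `x ∈ ℤ⁴` lies in the window box `Δ(p′)` (B7 (46) as typed: `[L⌊x∕L⌋, L⌊x∕L⌋ + (L−1)𝟙 + Le_μ + Le_ν]`)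
of its own block, for any plane `(μ, ν)` (`L ≥ 1`). [folklore] -/
theorem inBox_block {L : ℕ} (hL : 1 ≤ L) (x : B7Prop1Explicit.Site 4) (μ ν : Fin 4) :
    InBox ((L : ℤ) • (fun i => x i / (L : ℤ))) (deltaHi L ((L : ℤ) • (fun i => x i / (L : ℤ))) μ ν) x := by
  intro i
  have hL0 : (0 : ℤ) < L := by exact_mod_cast hL
  have h1 := Int.mul_ediv_add_emod (x i) (L : ℤ)
  have h2 := Int.emod_nonneg (x i) hL0.ne'
  have h3 := Int.emod_lt_of_pos (x i) hL0
  simp only [Pi.smul_apply, smul_eq_mul, deltaHi]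
  constructor
  · linarith
  · split_ifs <;> linarith

end Blocks

/-! ## §2 The constants' side conditions are jointly satisfiable (leaf B.4 / (w3) of SKELETON-NE7-P1) -/

section Constants

/-- **Leaf B.4 is [num].**  If Theorem 1's cube-size function `M(ε₁)` (`Cst.Mfun`) is unbounded at `0⁺` — a
HYPOTHESIS against the tree's abstract `B11Thm1.Consts` (the printed `M(ε₁) = R₁M₁(a₁∕ε₁)` has it when `M₁` is
unbounded) — then for every block size `L` and cube-size bound `Mc ≥ 0` some `ε₁` meets ALL the side conditions of the
gen-17 END simultaneously: `0 < ε₁`, `ε₁ ≤ a₁`, `ε₁ ≤ 1`, `Mc ≤ M(ε₁)`, `20480·L²·cReg(B₃Mc, B₃Mc)·ε₁ ≤ 1`.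
Pure real analysis on a right neighbourhood of `0`. [folklore] -/
theorem exists_eps1_smallness (Cst : B11Thm1.Consts) (L : ℕ) {Mc : ℝ} (hMc : 0 ≤ Mc)
    (hM : ∀ m : ℝ, ∀ᶠ e in 𝓝[>] (0 : ℝ), m ≤ Cst.Mfun e) :
    ∃ ε₁ : ℝ, 0 < ε₁ ∧ ε₁ ≤ Cst.a₁ ∧ ε₁ ≤ 1 ∧ Mc ≤ Cst.Mfun ε₁ ∧
      20480 * (L : ℝ) ^ 2 * (cReg (Cst.B₃ * Mc) (Cst.B₃ * Mc) * ε₁) ≤ 1 := by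
  set c : ℝ := 20480 * (L : ℝ) ^ 2 * cReg (Cst.B₃ * Mc) (Cst.B₃ * Mc) with hc_def
  have hB₃Mc : 0 ≤ Cst.B₃ * Mc := mul_nonneg Cst.B₃_pos.le hMc
  have hc : 0 ≤ c := by
    have := cReg_nonneg (Cst.B₃ * Mc) hB₃Mc
    positivity
  set δ : ℝ := min (min Cst.a₁ 1) (1 / (c + 1)) with hδ_def
  have hδ : 0 < δ := lt_min (lt_min Cst.a₁_pos one_pos) (by positivity)
  have hI : ∀ᶠ e in 𝓝[>] (0 : ℝ), e ∈ Set.Ioo 0 δ := Ioo_mem_nhdsGT hδ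
  obtain ⟨e, ⟨he0, heδ⟩, heM⟩ := (hI.and (hM Mc)).exists
  have hea : e ≤ Cst.a₁ := heδ.le.trans ((min_le_left _ _).trans (min_le_left _ _))
  have he1 : e ≤ 1 := heδ.le.trans ((min_le_left _ _).trans (min_le_right _ _))
  have hec : e ≤ 1 / (c + 1) := heδ.le.trans (min_le_right _ _)
  refine ⟨e, he0, hea, he1, heM, ?_⟩
  have hce : c * e ≤ c * (1 / (c + 1)) := mul_le_mul_of_nonneg_left hec hc
  have hc1 : c * (1 / (c + 1)) ≤ 1 := by
    rw [mul_one_div, div_le_one (by positivity)]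
    linarith
  calc 20480 * (L : ℝ) ^ 2 * (cReg (Cst.B₃ * Mc) (Cst.B₃ * Mc) * e) = c * e := by rw [hc_def]; ring
    _ ≤ 1 := hce.trans hc1

end Constants

/-! ## §3 The gen-17 END with the fine-label triple derived (leaf B.3 / (w2)) -/

section Ledger
variable {n : Type*} [Fintype n] [DecidableEq n] [Nonempty n]
variable {C : T4BoundaryCarrier.Carriers} {ι : Type} [MeasurableSpace ι] {σ : Type*} [DecidableEq σ] {l₀ vol : ℝ}
  {T : ℕ → Finset σ} {Bad : ℕ → ℝ → Finset σ} {A B : ℕ → ℝ → σ → ℝ} {μ : ℕ → ℝ → σ → Measure ι}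
  {fac bfac rfac : ℕ → ℝ → σ → Finset C.Dom} {Adm : Set ι} {EA : Functional C.toCarriers C.BgA}
  {EB : Functional C.toCarriers C.BgB} {BA : BFunctional C C.BgA} {BB : BFunctional C C.BgB}
  {RA : Functional C.toCarriers C.BgA} {RB : Functional C.toCarriers C.BgB}
  {κ θ' Cr EB₀ CrR R₁ b β' w₀ : ℝ} {κ₀ : ℕ} {gA gB : ℕ → ℕ → ℝ} {gfA gfB : ℕ → ℝ} {gsA gsB : ℕ → ℕ → ℝ}
  {uA : ℕ → ι → C.BgA} {uB : ℕ → ι → C.BgB} {oneA : C.BgA} {oneB : C.BgB}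
  {pend : ℕ → ℝ → σ → ι → C.Fl} {nA nB aA aB wA wB γA γB : ℕ → ℝ → σ → ι → ℝ} {qA qB : ℕ → ℝ}
  {κ₁ S : ℕ → ℝ → σ → ℕ → ℝ} {cW RW : ℕ → ℝ → σ → ℝ} {rw sw rγ zA zB c₀ : ℕ → ℝ} {Cw E a Λ Cl : ℝ}

/-- **THE GEN-17 END WITHOUT THE FINE-LABEL TRIPLE.**  `goodClause_summable_UN_levels_of_thm1At` (p204490) with
`lvlBf`, `hlvlBf`, `hcoverBf`, `hwinBf` no longer hypotheses: the fine plaquette `x` of run B is labelled by the level of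
its block's window, `lvlBf K t τ v x := lvlB K t τ v (x.1, ⌊x.2∕L⌋)`; its level bound, window clause and per-level
covering follow from the coarse ones (`hlvlB`, `hwinB`, `hcoverB`) by §1 (`block_mem_pbox`, `inBox_block`).  Every
other binder and the conclusion `GoodClause l₀ vol T A B Bad δ⁗ ∧ Summable δ⁗` VERBATIM as in the END (same `δ⁗`).
No estimate; `Thm1At` stays a hypothesis; NOT NE7, NOT Clay. [folklore] -/
theorem goodClause_summable_UN_levels_of_thm1At_coarse {Y YA : Type*} {Sfib : ℕ → ℝ → σ → ι → Set Y}
    {SfibA : ℕ → ℝ → σ → ι → Set YA} {g : ℕ → ℝ → σ → ι → YA → ℝ} {f₁ : ℕ → ℝ → σ → ι → Y → ℝ}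
    {Q : ℕ → ℝ → σ → ι → Y → YA} {yA yB : ℕ → ℝ → σ → ι → Y} {xA : ℕ → ℝ → σ → ι → YA}
    (M L : ℕ) (hMtwo : 2 ≤ M) (hLtwo : 2 ≤ L) (planes : Finset (Fin 4 × Fin 4))
    (hplanes : ∀ P ∈ planes, P.1 ≠ P.2)
    (famA famB : ℕ → ℝ → σ → ι → VarProblem)
    (ρA : ∀ K t τ v, Realises (famA K t τ v) 4 (Matrix n n ℂ)) (ρB : ∀ K t τ v, Realises (famB K t τ v) 4 (Matrix n n ℂ))
    (UA : ∀ K t τ v, (famA K t τ v).Cfg) (UB : ∀ K t τ v, (famB K t τ v).Cfg)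
    (lvlA lvlB : ℕ → ℝ → σ → ι → (Fin 4 × Fin 4) × B7Prop1Explicit.Site 4 → ℕ)
    (Cst : B11Thm1.Consts) {Mc ε₁ β₀ : ℝ}
    (hUR : ∀ K, URateUpTo K EA EB (gA K) (gB K) (uA K) (uB K) Adm Cr θ' κ) (hCr : 0 ≤ Cr)
    (hθ'0 : 0 < θ') (hθ'1 : θ' < 1) (hθ'Λ : θ' ≤ Λ) (hΛ1 : 1 ≤ Λ) (hCl : 0 ≤ Cl)
    (hURB : ∀ b ∈ C.admFl, ∀ K, URateUpTo K (atFl BA b) (atFl BB b) (gA K) (gB K) (uA K) (uB K) Adm EB₀ θ' κ)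
    (hEB₀ : 0 ≤ EB₀)
    (hURR : ∀ K, URateUpTo K RA RB (gA K) (gB K) (uA K) (uB K) Adm CrR θ' κ) (hCrR : 0 ≤ CrR)
    (hfmtA : ∀ K t τ, A K t τ = ∫ v, (∏ X ∈ fac K t τ,
      Real.exp (EA (gA K) (uA K v) X - EA (gA K) oneA X)) *
        ((∏ X ∈ bfac K t τ, Real.exp (BA (gA K) (uA K v) (pend K t τ v) X)) * nA K t τ v * qA K *
          ((∏ X ∈ rfac K t τ, Real.exp (RA (gA K) (uA K v) X - RA (gA K) oneA X)) * (Real.exp (-aA K t τ v) * wA K t τ v)))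
          ∂(μ K t τ))
    (hfmtB : ∀ K t τ, B K t τ = ∫ v, (∏ X ∈ fac K t τ,
      Real.exp (EB (gB K) (uB K v) X - EB (gB K) oneB X)) *
        ((∏ X ∈ bfac K t τ, Real.exp (BB (gB K) (uB K v) (pend K t τ v) X)) * nB K t τ v * qB K *
          ((∏ X ∈ rfac K t τ, Real.exp (RB (gB K) (uB K v) X - RB (gB K) oneB X)) * (Real.exp (-aB K t τ v) * wB K t τ v)))
          ∂(μ K t τ))
    (hint : ∀ K t, |t| ≤ l₀ → ∀ τ ∈ T K \ Bad K t,
      Integrable (fun v => (∏ X ∈ fac K t τ, Real.exp (EA (gA K) (uA K v) X - EA (gA K) oneA X)) *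
        ((∏ X ∈ bfac K t τ, Real.exp (BA (gA K) (uA K v) (pend K t τ v) X)) * nA K t τ v * qA K *
          ((∏ X ∈ rfac K t τ, Real.exp (RA (gA K) (uA K v) X - RA (gA K) oneA X)) * (Real.exp (-aA K t τ v) * wA K t τ v))))
          (μ K t τ) ∧
      Integrable (fun v => (∏ X ∈ fac K t τ, Real.exp (EB (gB K) (uB K v) X - EB (gB K) oneB X)) *
        ((∏ X ∈ bfac K t τ, Real.exp (BB (gB K) (uB K v) (pend K t τ v) X)) * nB K t τ v * qB K *
          ((∏ X ∈ rfac K t τ, Real.exp (RB (gB K) (uB K v) X - RB (gB K) oneB X)) * (Real.exp (-aB K t τ v) * wB K t τ v))))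
          (μ K t τ))
    (hsc : ∀ K t, |t| ≤ l₀ → ∀ τ ∈ T K \ Bad K t, ∀ X ∈ fac K t τ, C.scale X ≤ K)
    (hoff : ∀ K t, |t| ≤ l₀ → ∀ τ ∈ T K \ Bad K t, ∀ v, v ∉ Adm →
      (∏ X ∈ fac K t τ, Real.exp (EA (gA K) (uA K v) X - EA (gA K) oneA X)) *
        ((∏ X ∈ bfac K t τ, Real.exp (BA (gA K) (uA K v) (pend K t τ v) X)) * nA K t τ v * qA K *
          ((∏ X ∈ rfac K t τ, Real.exp (RA (gA K) (uA K v) X - RA (gA K) oneA X)) * (Real.exp (-aA K t τ v) * wA K t τ v)))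
          = 0 ∧
      (∏ X ∈ fac K t τ, Real.exp (EB (gB K) (uB K v) X - EB (gB K) oneB X)) *
        ((∏ X ∈ bfac K t τ, Real.exp (BB (gB K) (uB K v) (pend K t τ v) X)) * nB K t τ v * qB K *
          ((∏ X ∈ rfac K t τ, Real.exp (RB (gB K) (uB K v) X - RB (gB K) oneB X)) * (Real.exp (-aB K t τ v) * wB K t τ v)))
          = 0)
    (hS : ∀ K t, |t| ≤ l₀ → ∀ τ ∈ T K \ Bad K t, ∀ v ∈ Adm, ∀ j ≤ K,
      |(∑ X ∈ fac K t τ with C.scale X = j,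
          (Real.log (Real.exp (EB (gB K) (uB K v) X - EB (gB K) oneB X))
            - Real.log (Real.exp (EA (gA K) (uA K v) X - EA (gA K) oneA X)))) - κ₁ K t τ j| ≤ S K t τ j)
    (hM : ∀ K t, |t| ≤ l₀ → ∀ τ ∈ T K \ Bad K t,
      Multiplicity (fac K t τ) C.scale (fun X => Real.exp (-(κ * C.d X))) Cw vol Λ K)
    (hwit : ∀ K, ∃ v₁ ∈ Adm, uA K v₁ = oneA ∧ uB K v₁ = oneB)
    (hvol : 0 ≤ vol) (hE : 0 ≤ E) (ha0 : 0 < a) (ha1 : a < 1)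
    (hSle : ∀ K t, |t| ≤ l₀ → ∀ τ ∈ T K \ Bad K t, ∀ j ≤ K, S K t τ j ≤ vol * (E * a ^ (K - j)))
    (hpend : ∀ K t, |t| ≤ l₀ → ∀ τ ∈ T K \ Bad K t, ∀ v ∈ Adm, pend K t τ v ∈ C.admFl)
    (hBwin : ∀ K t, |t| ≤ l₀ → ∀ τ ∈ T K \ Bad K t, RecentOnly (bfac K t τ) C.scale (jlogOf Cl K) K)
    (hMB : ∀ K t, |t| ≤ l₀ → ∀ τ ∈ T K \ Bad K t,
      Multiplicity (bfac K t τ) C.scale (fun X => Real.exp (-(κ * C.d X))) Cw vol Λ K)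
    (hnpos : ∀ K t, |t| ≤ l₀ → ∀ τ ∈ T K \ Bad K t, ∀ v ∈ Adm, 0 < nA K t τ v ∧ 0 < nB K t τ v)
    (hzA : ∀ K t, |t| ≤ l₀ → ∀ τ ∈ T K \ Bad K t, ∀ v ∈ Adm, |Real.log (nA K t τ v)| ≤ vol * zA K)
    (hzB : ∀ K t, |t| ≤ l₀ → ∀ τ ∈ T K \ Bad K t, ∀ v ∈ Adm, |Real.log (nB K t τ v)| ≤ vol * zB K)
    (hzAs : Summable zA) (hzBs : Summable zB)
    (hq : ∀ K, 0 < qA K ∧ 0 < qB K)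
    -- the 𝐑-kind: scales, multiplicity, one-run slice sizes, the flow window of both coupling tables
    (hrsc : ∀ K t, |t| ≤ l₀ → ∀ τ ∈ T K \ Bad K t, ∀ X ∈ rfac K t τ, C.scale X ≤ K)
    (hMR : ∀ K t, |t| ≤ l₀ → ∀ τ ∈ T K \ Bad K t,
      Multiplicity (rfac K t τ) C.scale (fun X => Real.exp (-(κ * C.d X))) Cw vol Λ K)
    (hRSA : ∀ K t, |t| ≤ l₀ → ∀ τ ∈ T K \ Bad K t, ∀ v ∈ Adm, ∀ j ≤ K,
      |∑ X ∈ rfac K t τ with C.scale X = j, (RA (gA K) (uA K v) X - RA (gA K) oneA X)| ≤ vol * (R₁ * gsA K j ^ κ₀))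
    (hRSB : ∀ K t, |t| ≤ l₀ → ∀ τ ∈ T K \ Bad K t, ∀ v ∈ Adm, ∀ j ≤ K,
      |∑ X ∈ rfac K t τ with C.scale X = j, (RB (gB K) (uB K v) X - RB (gB K) oneB X)| ≤ vol * (R₁ * gsB K j ^ κ₀))
    (hb : 0 < b) (h031A : ∀ K, Step.Discrete031 b β' K (gfA K) (gsA K))
    (h031B : ∀ K, Step.Discrete031 b β' K (gfB K) (gsB K)) (hgsA : ∀ K k, k ≤ K → 0 ≤ gsA K k)
    (hgsB : ∀ K k, k ≤ K → 0 ≤ gsB K k) (hR₁ : 0 ≤ R₁) (hκ₀ : 4 < κ₀)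
    -- the ACTION kind from ONE CLASSICAL STEP: (min-A) (Q) (lift) (min-B) (act) (U) (L) (γ)
    (hminA : ∀ K t, |t| ≤ l₀ → ∀ τ ∈ T K \ Bad K t, ∀ v ∈ Adm, IsMinOn (g K t τ v) (SfibA K t τ v) (xA K t τ v))
    (hQ : ∀ K t, |t| ≤ l₀ → ∀ τ ∈ T K \ Bad K t, ∀ v ∈ Adm, Set.MapsTo (Q K t τ v) (Sfib K t τ v) (SfibA K t τ v))
    (hlift : ∀ K t, |t| ≤ l₀ → ∀ τ ∈ T K \ Bad K t, ∀ v ∈ Adm,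
      yA K t τ v ∈ Sfib K t τ v ∧ Q K t τ v (yA K t τ v) = xA K t τ v)
    (hminB : ∀ K t, |t| ≤ l₀ → ∀ τ ∈ T K \ Bad K t, ∀ v ∈ Adm,
      yB K t τ v ∈ Sfib K t τ v ∧ IsMinOn (f₁ K t τ v) (Sfib K t τ v) (yB K t τ v))
    (hact : ∀ K t, |t| ≤ l₀ → ∀ τ ∈ T K \ Bad K t, ∀ v ∈ Adm,
      aA K t τ v = w₀ * g K t τ v (xA K t τ v) + γA K t τ v ∧
        aB K t τ v = w₀ * f₁ K t τ v (yB K t τ v) + γB K t τ v)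
    (hw₀ : 0 ≤ w₀)
    -- (U)(L) PRODUCED for G = U(N) Wilson terms from the PRINTED-CURRENCY regularity binder PER WINDOW AT THE WINDOW's
    -- LEVEL (`HolderReg` = B11 Thm 1 (9) read with B9 (3.40) at U₀ = 1, spacing (L^{lvl y})⁻¹, Hölder exponent β₀):
    -- unitarity + periodicity `hAU hBU`, `hA9W hB9W` on the window boxes, `hB9F` at run B's fine plaquettes, the
    -- window clauses `hwinA hwinB hwinBf`, the constants' signs, `ε₁ ≤ 1`, the smallness, `0 < β₀ ≤ 1`
    (hAU : ∀ K t, |t| ≤ l₀ → ∀ τ ∈ T K \ Bad K t, ∀ v ∈ Adm,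
      (∀ x κ, (ρA K t τ v).cfg (UA K t τ v) x κ ∈ unitaryUnits (Matrix n n ℂ)) ∧
        IsPeriodic (M * L ^ K * L) ((ρA K t τ v).cfg (UA K t τ v)))
    (hBU : ∀ K t, |t| ≤ l₀ → ∀ τ ∈ T K \ Bad K t, ∀ v ∈ Adm,
      (∀ x κ, (ρB K t τ v).cfg (UB K t τ v) x κ ∈ unitaryUnits (Matrix n n ℂ)) ∧
        IsPeriodic (M * L ^ K * L) ((ρB K t τ v).cfg (UB K t τ v)))
    -- THE TYPED THEOREM 1 PER RUN (one block of constants `Cst`), its data, and the PER-LEVEL coverings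
    (hPLA : ∀ K t τ v, (famA K t τ v).L = (L : ℝ)) (hetaA : ∀ K t τ v, (famA K t τ v).eta = ((L : ℝ) ^ K)⁻¹)
    (hPLB : ∀ K t τ v, (famB K t τ v).L = (L : ℝ)) (hetaB : ∀ K t τ v, (famB K t τ v).eta = ((L : ℝ) ^ K)⁻¹)
    (hTA : ∀ K t τ v, B11Thm1.Thm1At Cst (famA K t τ v)) (hTB : ∀ K t τ v, B11Thm1.Thm1At Cst (famB K t τ v))
    (hε₁a : ε₁ ≤ Cst.a₁) (VbA : ∀ K t τ v, (famA K t τ v).Bdry) (VbB : ∀ K t τ v, (famB K t τ v).Bdry)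
    (hVbA : ∀ K t τ v, (famA K t τ v).Reg7 ε₁ (VbA K t τ v)) (hVbB : ∀ K t τ v, (famB K t τ v).Reg7 ε₁ (VbB K t τ v))
    (hUA : ∀ K t τ v, (famA K t τ v).OnMinimalOrbit (Cst.B₃ * ε₁) (VbA K t τ v) (UA K t τ v))
    (hUB : ∀ K t τ v, (famB K t τ v).OnMinimalOrbit (Cst.B₃ * ε₁) (VbB K t τ v) (UB K t τ v))
    (hMc0 : 0 ≤ Mc) (hMc : Mc ≤ Cst.Mfun ε₁)
    (hlvlA : ∀ K t τ v, ∀ y ∈ pbox planes (M * L ^ K), lvlA K t τ v y ≤ K)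
    (hlvlB : ∀ K t τ v, ∀ y ∈ pbox planes (M * L ^ K), lvlB K t τ v y ≤ K)
    (hcoverA : ∀ K t, |t| ≤ l₀ → ∀ τ ∈ T K \ Bad K t, ∀ v ∈ Adm, ∀ y ∈ pbox planes (M * L ^ K),
      ∀ x : B7Prop1Explicit.Site 4, InBox ((L : ℤ) • y.2) (deltaHi L ((L : ℤ) • y.2) y.1.1 y.1.2) x →
        ∃ c : (famA K t τ v).Cube, (famA K t τ v).scale c = lvlA K t τ v y ∧ (famA K t τ v).sizeM c ≤ Mc ∧
          l1 (x - (ρA K t τ v).centre c) + 6 ≤ (ρA K t τ v).radius c)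
    (hcoverB : ∀ K t, |t| ≤ l₀ → ∀ τ ∈ T K \ Bad K t, ∀ v ∈ Adm, ∀ y ∈ pbox planes (M * L ^ K),
      ∀ x : B7Prop1Explicit.Site 4, InBox ((L : ℤ) • y.2) (deltaHi L ((L : ℤ) • y.2) y.1.1 y.1.2) x →
        ∃ c : (famB K t τ v).Cube, (famB K t τ v).scale c = lvlB K t τ v y ∧ (famB K t τ v).sizeM c ≤ Mc ∧
          l1 (x - (ρB K t τ v).centre c) + 6 ≤ (ρB K t τ v).radius c)
    (hwinA : ∀ K t, |t| ≤ l₀ → ∀ τ ∈ T K \ Bad K t, ∀ v ∈ Adm,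
      RecentOnly (pbox planes (M * L ^ K)) (lvlA K t τ v) (jlogOf Cl K) K)
    (hwinB : ∀ K t, |t| ≤ l₀ → ∀ τ ∈ T K \ Bad K t, ∀ v ∈ Adm,
      RecentOnly (pbox planes (M * L ^ K)) (lvlB K t τ v) (jlogOf Cl K) K)
    (hε₁ : 0 < ε₁) (hε₁1 : ε₁ ≤ 1)
    (hsmall : 20480 * (L : ℝ) ^ 2 * (cReg (Cst.B₃ * Mc) (Cst.B₃ * Mc) * ε₁) ≤ 1) (hβ₀ : 0 < β₀) (hβ₀1 : β₀ ≤ 1)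
    (hreprU : ∀ K t, |t| ≤ l₀ → ∀ τ ∈ T K \ Bad K t, ∀ v ∈ Adm,
      f₁ K t τ v (yA K t τ v) = ∑ x ∈ pbox planes (M * L ^ K * L), eN (phiU ((ρA K t τ v).cfg (UA K t τ v)) x) ∧
        g K t τ v (xA K t τ v) = ∑ y ∈ pbox planes (M * L ^ K), eN (psiU L ((ρA K t τ v).cfg (UA K t τ v)) y))
    (hreprL : ∀ K t, |t| ≤ l₀ → ∀ τ ∈ T K \ Bad K t, ∀ v ∈ Adm,
      f₁ K t τ v (yB K t τ v) = ∑ x ∈ pbox planes (M * L ^ K * L), eN (phiU ((ρB K t τ v).cfg (UB K t τ v)) x) ∧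
        g K t τ v (Q K t τ v (yB K t τ v)) = ∑ y ∈ pbox planes (M * L ^ K), eN (psiU L ((ρB K t τ v).cfg (UB K t τ v)) y))
    (hMvol : ((M : ℝ)) ^ 4 ≤ vol)
    (hγ : ∀ K t, |t| ≤ l₀ → ∀ τ ∈ T K \ Bad K t, ∀ v ∈ Adm, |γB K t τ v - γA K t τ v| ≤ vol * rγ K)
    (hrγ : Summable rγ)
    -- the residual kind after generation 8: (R-w) radii about a centre `cW`, (W-w) the WITNESS log-ratio centred
    (hwpos : ∀ K t, |t| ≤ l₀ → ∀ τ ∈ T K \ Bad K t, ∀ v ∈ Adm, 0 < wA K t τ v ∧ 0 < wB K t τ v)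
    (hRw : ∀ K t, |t| ≤ l₀ → ∀ τ ∈ T K \ Bad K t, ∀ v ∈ Adm,
      |Real.log (wB K t τ v) - Real.log (wA K t τ v) - cW K t τ| ≤ RW K t τ)
    (hRRw : ∀ K t, |t| ≤ l₀ → ∀ τ ∈ T K \ Bad K t, RW K t τ ≤ vol * rw K) (hrw : Summable rw)
    (hWw : ∀ K t, |t| ≤ l₀ → ∀ τ ∈ T K \ Bad K t, ∀ v ∈ Adm, uA K v = oneA → uB K v = oneB →
      |Real.log (wB K t τ v) - Real.log (wA K t τ v) - c₀ K| ≤ vol * sw K)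
    (hsw : Summable sw) :
    GoodClause l₀ vol T A B Bad
        (fun K => (max Cw 1 * ((E + Cr) * ∑ x ∈ antidiagonal K, min (a ^ x.2) (θ' ^ x.1 * Λ ^ x.2))
            + (EB₀ * Cw * windowSum θ' Λ (jlogOf Cl K) K + (zA K + zB K)
              + (max (2 * Cw) 1 * ((∑ p ∈ antidiagonal K, min (R₁ * gsA K p.1 ^ κ₀) (CrR * θ' ^ p.1 * Λ ^ p.2))
                  + ∑ p ∈ antidiagonal K, min (R₁ * gsB K p.1 ^ κ₀) (CrR * θ' ^ p.1 * Λ ^ p.2))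
                + (w₀ * ((planes.card : ℝ) * (cOSC L (cOscReg L (Cst.B₃ * Mc) (Cst.B₃ * Mc) (Cst.B₄ * Mc)) ^ 2 * ε₁ ^ 2 / 4
                        * windowSum (((L : ℝ) ^ (-β₀)) ^ 2) ((L : ℝ) ^ 4) (jlogOf Cl K) K
                      + (cSZ L (cReg (Cst.B₃ * Mc) (Cst.B₃ * Mc)) * cBCH L (cReg (Cst.B₃ * Mc) (Cst.B₃ * Mc)) * ε₁ ^ 3
                          + (Fintype.card n : ℝ) / 24 * (cSZ L (cReg (Cst.B₃ * Mc) (Cst.B₃ * Mc)) * ε₁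
                            + cBCH L (cReg (Cst.B₃ * Mc) (Cst.B₃ * Mc)) * ε₁ ^ 2) ^ 4)
                        * windowSum (((L : ℝ) ^ 2)⁻¹) ((L : ℝ) ^ 4) (jlogOf Cl K) K)
                    + (planes.card : ℝ)
                      * (cSZ L (cReg (Cst.B₃ * Mc) (Cst.B₃ * Mc)) * cBCH L (cReg (Cst.B₃ * Mc) (Cst.B₃ * Mc)) * ε₁ ^ 3
                        + cBCH L (cReg (Cst.B₃ * Mc) (Cst.B₃ * Mc)) ^ 2 * ε₁ ^ 4 / 2
                        + (Fintype.card n : ℝ) / 24 * (cSZ L (cReg (Cst.B₃ * Mc) (Cst.B₃ * Mc)) ^ 4 * ε₁ ^ 4))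
                      * windowSum (((L : ℝ) ^ 2)⁻¹) ((L : ℝ) ^ 4) (jlogOf Cl K) K)
                  + rγ K + rw K))))
          + (max Cw 1 * ((E + Cr) * ∑ x ∈ antidiagonal K, min (a ^ x.2) (θ' ^ x.1 * Λ ^ x.2)) + (rw K + sw K))) ∧
      Summable (fun K => (max Cw 1 * ((E + Cr) * ∑ x ∈ antidiagonal K, min (a ^ x.2) (θ' ^ x.1 * Λ ^ x.2))
            + (EB₀ * Cw * windowSum θ' Λ (jlogOf Cl K) K + (zA K + zB K)
              + (max (2 * Cw) 1 * ((∑ p ∈ antidiagonal K, min (R₁ * gsA K p.1 ^ κ₀) (CrR * θ' ^ p.1 * Λ ^ p.2))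
                  + ∑ p ∈ antidiagonal K, min (R₁ * gsB K p.1 ^ κ₀) (CrR * θ' ^ p.1 * Λ ^ p.2))
                + (w₀ * ((planes.card : ℝ) * (cOSC L (cOscReg L (Cst.B₃ * Mc) (Cst.B₃ * Mc) (Cst.B₄ * Mc)) ^ 2 * ε₁ ^ 2 / 4
                        * windowSum (((L : ℝ) ^ (-β₀)) ^ 2) ((L : ℝ) ^ 4) (jlogOf Cl K) K
                      + (cSZ L (cReg (Cst.B₃ * Mc) (Cst.B₃ * Mc)) * cBCH L (cReg (Cst.B₃ * Mc) (Cst.B₃ * Mc)) * ε₁ ^ 3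
                          + (Fintype.card n : ℝ) / 24 * (cSZ L (cReg (Cst.B₃ * Mc) (Cst.B₃ * Mc)) * ε₁
                            + cBCH L (cReg (Cst.B₃ * Mc) (Cst.B₃ * Mc)) * ε₁ ^ 2) ^ 4)
                        * windowSum (((L : ℝ) ^ 2)⁻¹) ((L : ℝ) ^ 4) (jlogOf Cl K) K)
                    + (planes.card : ℝ)
                      * (cSZ L (cReg (Cst.B₃ * Mc) (Cst.B₃ * Mc)) * cBCH L (cReg (Cst.B₃ * Mc) (Cst.B₃ * Mc)) * ε₁ ^ 3
                        + cBCH L (cReg (Cst.B₃ * Mc) (Cst.B₃ * Mc)) ^ 2 * ε₁ ^ 4 / 2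
                        + (Fintype.card n : ℝ) / 24 * (cSZ L (cReg (Cst.B₃ * Mc) (Cst.B₃ * Mc)) ^ 4 * ε₁ ^ 4))
                      * windowSum (((L : ℝ) ^ 2)⁻¹) ((L : ℝ) ^ 4) (jlogOf Cl K) K)
                  + rγ K + rw K))))
          + (max Cw 1 * ((E + Cr) * ∑ x ∈ antidiagonal K, min (a ^ x.2) (θ' ^ x.1 * Λ ^ x.2)) + (rw K + sw K))) := by
  refine goodClause_summable_UN_levels_of_thm1At
    M L hMtwo hLtwo planes hplanes famA famB ρA ρB UA UB lvlA lvlB (fun K t τ v x => lvlB K t τ v (x.1, fun i => x.2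
    i / (L : ℤ))) Cst hUR hCr hθ'0 hθ'1 hθ'Λ hΛ1 hCl hURB hEB₀ hURR hCrR hfmtA hfmtB hint hsc hoff hS hM hwit hvol hE
    ha0 ha1 hSle hpend hBwin hMB hnpos hzA hzB hzAs hzBs hq hrsc hMR hRSA hRSB hb h031A h031B hgsA hgsB hR₁ hκ₀ hminA
    hQ hlift hminB hact hw₀ hAU hBU hPLA hetaA hPLB hetaB hTA hTB hε₁a VbA VbB hVbA hVbB hUA hUB hMc0 hMc hlvlA hlvlB
    ?_ hcoverA hcoverB ?_ hwinA hwinB ?_ hε₁ hε₁1 hsmall hβ₀ hβ₀1 hreprU hreprL hMvol hγ hrγ hwpos hRw hRRw hrw hWw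
    hsw
  · intro K t τ v x hx
    exact hlvlB K t τ v _ (block_mem_pbox (by omega) hx)
  · intro K t ht τ hτ v hv x hx z hz
    subst hz
    exact hcoverB K t ht τ hτ v hv _ (block_mem_pbox (by omega) hx) x.2 (inBox_block (by omega) x.2 x.1.1 x.1.2)
  · intro K t ht τ hτ v hv x hx
    exact hwinB K t ht τ hτ v hv _ (block_mem_pbox (by omega) hx)

end Ledger

end Summit.QuantumFields.BalabanUV.T4Continuum.TermwiseLocal
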